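import Summits.MatrixMultiplication.OmegaCensus.STPP222CubeClauses

/-!
# ω-census, the pattern `(2,2,2)³`: the slot-padded product encoding for the kernel mask engine

HONEST FRAMING (pub-omega census; verbatim): lottery ticket; floor = certified bounds/negative ranges.
Census STRUCTURE bookkeeping (question Q7, row `k = 3`: the lower half `n₃ ≥ 32`), not progress on `ω`.

`prodEnc3 E₁ E₂ s`: from encodings of `G₁`, `G₂` (`Enc3`, `STPP222CubeClauses.lean`) an encoding of `G₁ × G₂` with code
`enc₁ x · 2^s + enc₂ y`, the second component living in a slot of `s` bits wide enough (`12 · off₂ < 2^s`) that signed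
sums of at most six terms of each sign never carry between the slots; `reduce` / `neg` act slot-wise.  Used (nested)
for the non-cyclic abelian groups of order 24–31: `ℤ₂×ℤ₄×ℤ₃`, `ℤ₂³×ℤ₃`, `ℤ₅²`, `ℤ₃×ℤ₉`, `ℤ₃³`, `ℤ₂²×ℤ₇`.

References: H. Cohn, R. Kleinberg, B. Szegedy, C. Umans, FOCS 2005 (arXiv:math/0511460), Def. 5.1.
Record: pub-omega HOME `pub-omega-eng2/results/c4red/K2-THRESHOLD-eng2.md` §NEG3 (ENG2 gen 18, 2026-08-23).
-/

namespace Summit.MatrixMultiplication.OmegaCensus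

namespace STPP222CubeNeg

/-- Slot arithmetic of a product: `reduce` and `neg` act on the high part (`/ 2^s`) and the low slot (`% 2^s`). -/
def prodArith (A₁ A₂ : Arith) (s : ℕ) : Arith where
  reduce t := A₁.reduce (t / 2 ^ s) * 2 ^ s + A₂.reduce (t % 2 ^ s)
  neg c := A₁.neg (c / 2 ^ s) * 2 ^ s + A₂.neg (c % 2 ^ s)
  off := A₁.off * 2 ^ s + A₂.off

/-- Sums of product codes split into slots. -/
theorem sum_map_prod {G₁ G₂ : Type} (f₁ : G₁ → ℕ) (f₂ : G₂ → ℕ) (R : ℕ) (P : List (G₁ × G₂)) :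
    (P.map fun x => f₁ x.1 * R + f₂ x.2).sum = ((P.map Prod.fst).map f₁).sum * R + ((P.map Prod.snd).map f₂).sum := by
  induction P with
  | nil => simp
  | cons x P ih => simp only [List.map_cons, List.sum_cons, ih]; ring

/-- Components of a list sum in a product group. -/
theorem fst_sum {G₁ G₂ : Type} [AddCommGroup G₁] [AddCommGroup G₂] (P : List (G₁ × G₂)) :
    P.sum.1 = (P.map Prod.fst).sum ∧ P.sum.2 = (P.map Prod.snd).sum := by
  induction P with
  | nil => simp
  | cons x P ih => simp [ih.1, ih.2]

/-- High part and low slot of a padded number. -/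
theorem div_mod_slot {R h l : ℕ} (hR : 0 < R) (hl : l < R) : (h * R + l) / R = h ∧ (h * R + l) % R = l := by
  constructor
  · rw [Nat.add_comm, Nat.add_mul_div_right _ _ hR, Nat.div_eq_of_lt hl, Nat.zero_add]
  · rw [Nat.add_comm, Nat.add_mul_mod_self_right, Nat.mod_eq_of_lt hl]

/-- THE PRODUCT ENCODING: codes `enc₁ x · 2^s + enc₂ y` with a low slot of `s` bits, `12 · off₂ < 2^s`. -/
def prodEnc3 {G₁ G₂ : Type} [AddCommGroup G₁] [AddCommGroup G₂] (E₁ : Enc3 G₁) (E₂ : Enc3 G₂) (s : ℕ)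
    (hs : 12 * E₂.A.off < 2 ^ s) : Enc3 (G₁ × G₂) where
  A := prodArith E₁.A E₂.A s
  enc x := E₁.enc x.1 * 2 ^ s + E₂.enc x.2
  enc_inj x y h := by
    have hR : 0 < 2 ^ s := Nat.pos_of_ne_zero (by positivity)
    have hx := div_mod_slot (h := E₁.enc x.1) hR (lt_of_le_of_lt (E₂.enc_le x.2) (by omega))
    have hy := div_mod_slot (h := E₁.enc y.1) hR (lt_of_le_of_lt (E₂.enc_le y.2) (by omega))
    simp only at h
    have h1 : E₁.enc x.1 = E₁.enc y.1 := by rw [← hx.1, ← hy.1, h]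
    have h2 : E₂.enc x.2 = E₂.enc y.2 := by rw [← hx.2, ← hy.2, h]
    exact Prod.ext (E₁.enc_inj h1) (E₂.enc_inj h2)
  enc_zero := by simp [E₁.enc_zero, E₂.enc_zero]
  enc_le x := by
    show E₁.enc x.1 * 2 ^ s + E₂.enc x.2 ≤ E₁.A.off * 2 ^ s + E₂.A.off
    exact Nat.add_le_add (Nat.mul_le_mul_right _ (E₁.enc_le x.1)) (E₂.enc_le x.2)
  reduce_sum P M hP hM := by
    show E₁.A.reduce (((E₁.A.off * 2 ^ s + E₂.A.off) * M.length + (P.map fun x => E₁.enc x.1 * 2 ^ s + E₂.enc x.2).sum -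
        (M.map fun x => E₁.enc x.1 * 2 ^ s + E₂.enc x.2).sum) / 2 ^ s) * 2 ^ s +
      E₂.A.reduce (((E₁.A.off * 2 ^ s + E₂.A.off) * M.length + (P.map fun x => E₁.enc x.1 * 2 ^ s + E₂.enc x.2).sum -
        (M.map fun x => E₁.enc x.1 * 2 ^ s + E₂.enc x.2).sum) % 2 ^ s) =
      E₁.enc (P.sum - M.sum).1 * 2 ^ s + E₂.enc (P.sum - M.sum).2
    rw [sum_map_prod, sum_map_prod]
    set P₁ := P.map Prod.fst
    set P₂ := P.map Prod.snd
    set M₁ := M.map Prod.fst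
    set M₂ := M.map Prod.snd
    have hM₁ : (M₁.map E₁.enc).sum ≤ E₁.A.off * M₁.length := sum_enc_le E₁ M₁
    have hM₂ : (M₂.map E₂.enc).sum ≤ E₂.A.off * M₂.length := sum_enc_le E₂ M₂
    have hP₂ : (P₂.map E₂.enc).sum ≤ E₂.A.off * P₂.length := sum_enc_le E₂ P₂
    have lM₁ : M₁.length = M.length := List.length_map _
    have lM₂ : M₂.length = M.length := List.length_map _
    have lP₂ : P₂.length = P.length := List.length_map _
    have hR : 0 < 2 ^ s := Nat.pos_of_ne_zero (by positivity)
    -- the padded difference splits slot-wise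
    have hsplit : (E₁.A.off * 2 ^ s + E₂.A.off) * M.length + ((P₁.map E₁.enc).sum * 2 ^ s + (P₂.map E₂.enc).sum) -
        ((M₁.map E₁.enc).sum * 2 ^ s + (M₂.map E₂.enc).sum) =
        (E₁.A.off * M₁.length + (P₁.map E₁.enc).sum - (M₁.map E₁.enc).sum) * 2 ^ s +
          (E₂.A.off * M₂.length + (P₂.map E₂.enc).sum - (M₂.map E₂.enc).sum) := by
      rw [lM₁, lM₂]
      rw [lM₁] at hM₁; rw [lM₂] at hM₂
      have h1 : (M₁.map E₁.enc).sum ≤ E₁.A.off * M.length + (P₁.map E₁.enc).sum := le_trans hM₁ (Nat.le_add_right _ _)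
      have h2 : (M₂.map E₂.enc).sum ≤ E₂.A.off * M.length + (P₂.map E₂.enc).sum := le_trans hM₂ (Nat.le_add_right _ _)
      have h3 : (M₁.map E₁.enc).sum * 2 ^ s + (M₂.map E₂.enc).sum ≤
          (E₁.A.off * M.length + (P₁.map E₁.enc).sum) * 2 ^ s + (E₂.A.off * M.length + (P₂.map E₂.enc).sum) :=
        Nat.add_le_add (Nat.mul_le_mul_right _ h1) h2
      have e : (E₁.A.off * 2 ^ s + E₂.A.off) * M.length + ((P₁.map E₁.enc).sum * 2 ^ s + (P₂.map E₂.enc).sum) =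
          (E₁.A.off * M.length + (P₁.map E₁.enc).sum) * 2 ^ s + (E₂.A.off * M.length + (P₂.map E₂.enc).sum) := by ring
      rw [e]
      zify [h1, h2, h3]
      ring
    have hlow : E₂.A.off * M₂.length + (P₂.map E₂.enc).sum - (M₂.map E₂.enc).sum < 2 ^ s := by
      have : E₂.A.off * M₂.length + (P₂.map E₂.enc).sum ≤ 12 * E₂.A.off := by
        rw [lM₂]; rw [lP₂] at hP₂; nlinarith
      omega
    obtain ⟨hdiv, hmod⟩ := div_mod_slot (h := E₁.A.off * M₁.length + (P₁.map E₁.enc).sum - (M₁.map E₁.enc).sum) hR hlow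
    rw [hsplit, hdiv, hmod, E₁.reduce_sum P₁ M₁ (by rw [List.length_map]; exact hP) (by rw [lM₁]; exact hM),
      E₂.reduce_sum P₂ M₂ (by rw [lP₂]; exact hP) (by rw [lM₂]; exact hM), Prod.fst_sub, Prod.snd_sub, (fst_sum P).1,
      (fst_sum P).2, (fst_sum M).1, (fst_sum M).2]
  neg_enc x := by
    show E₁.A.neg ((E₁.enc x.1 * 2 ^ s + E₂.enc x.2) / 2 ^ s) * 2 ^ s + E₂.A.neg ((E₁.enc x.1 * 2 ^ s + E₂.enc x.2) % 2 ^ s)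
      = E₁.enc (-x).1 * 2 ^ s + E₂.enc (-x).2
    have hR : 0 < 2 ^ s := Nat.pos_of_ne_zero (by positivity)
    obtain ⟨hdiv, hmod⟩ := div_mod_slot (h := E₁.enc x.1) hR (lt_of_le_of_lt (E₂.enc_le x.2) (by omega))
    rw [hdiv, hmod, E₁.neg_enc, E₂.neg_enc, Prod.fst_neg, Prod.snd_neg]

end STPP222CubeNeg

end Summit.MatrixMultiplication.OmegaCensus
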